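import Literature.Topology.FourManifolds.KirbyMovesSlideSweepExchange
import HarnessLib

/-!
# The handle-slide sweep, planar part IV: the exchange of two graphs of a meridian slice

Topic `Literature/Topology/FourManifolds`; fact seat `provefact-IsStrictHandleSlide.isSurgery`
(R. C. Kirby, *The Topology of 4-Manifolds*, LNM 1374 (1989), Ch. I §4, p. 10, Figs. 4.2–4.3 and
§5 Thm. 5.1 (1): the slide of an attaching circle over a 2-handle is an isotopy across the
meridian disc `Δ` of the new solid torus in `Yⱼ = ∂(B⁴ ∪ hⱼ)`; remaining content in the tree: the
named fact (S) `Literature.Topology.FourManifolds.FramedLink.IsStrictHandleSlide.slideModel`,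
`KirbyMovesHandleSlide.lean`). Continuation of `KirbyMovesSlideSweepExchange.lean`; this file
assembles **the planar sweep** in the form consumed by the slide:

* `Literature.Topology.FourManifolds.SlideSweep.exists_planarSweep` — data: a twist strength
  `c`, a tip height `Y ≥ 0`, a radius `ρ` with `Y ≤ ρ`, a margin `m > 0`, and two smooth functions
  `g₁, g₂ : ℝ → ℝ` which agree for `|y| ≥ Y` and whose graphs over `[-Y, Y]`, together with the
  horizontal segments between them, lie in the closed disc of radius `ρ`. Conclusion: a
  diffeomorphism `Λ` of the plane (the twist of `exists_twistDiffeomorph`, explicit with its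
  inverse on the disc of radius `ρ + 2m`, norm-preserving there) and an ambient isotopy `σ` of the
  plane, stationary off the disc of radius `ρ + m`, which at time `1` carries the arc
  `y ↦ Λ⁻¹ (g₂ y, y)`, `|y| ≤ Y`, onto the arc `y ↦ Λ⁻¹ (g₁ y, y)` pointwise, and which at all times
  `0 ≤ t ≤ 1` fixes `Λ⁻¹` of the two half planes `{|y| ≥ Y}` within the disc of radius `ρ`.
  Construction: the supported horizontal push by `g₁ - g₂` in the twisted chart
  (`exists_ambientIsotopy_horizontalPush_of_subset`), conjugated by `Λ`
  (`AmbientIsotopy.transfer`, support by `transfer_eq_self_of_norm_le`). Hirsch, *Differential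
  Topology* (1976), Ch. 8 §1.

In the surgered tube `g₁` carries the long arc of the push-off `Kⱼ'` (the circle of radius `R`
read in the twisted chart) with the flanks by which the slid circle reaches it, `g₂` the arc of
the slid circle just before it crosses `Δ`, and the half planes `{|y| ≥ Y}` contain the common
stubs of the two (Kirby (1989), Fig. 4.2).

## References

* R. C. Kirby, *The Topology of 4-Manifolds*, LNM 1374, Springer (1989), Ch. I §4, §5 Thm. 5.1.
  [Kirby1989]
* M. W. Hirsch, *Differential Topology*, GTM 33, Springer (1976), Ch. 8 §1, Thms. 1.2–1.3.
  [HirschDT1976]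
-/

open scoped Manifold ContDiff Topology
open Function Set Metric

noncomputable section

namespace Literature.Topology.FourManifolds

namespace SlideSweep

/-- **The planar sweep.** See the module docstring. [cite: Kirby1989, Ch. I §4] -/
theorem exists_planarSweep (c : ℝ) {Y ρ m : ℝ} (hY : 0 ≤ Y) (hYρ : Y ≤ ρ) (hm : 0 < m) {g₁ g₂ : ℝ → ℝ}
    (hg₁ : ContDiff ℝ ∞ g₁) (hg₂ : ContDiff ℝ ∞ g₂) (heq : ∀ y, Y ≤ |y| → g₁ y = g₂ y)
    (hbound : ∀ y, |y| ≤ Y → ∀ θ ∈ Icc (0 : ℝ) 1,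
      (g₂ y + θ * (g₁ y - g₂ y)) ^ 2 + y ^ 2 ≤ ρ ^ 2) :
    ∃ (Λ : EuclideanSpace ℝ (Fin 2) ≃ₘ⟮𝓘(ℝ, EuclideanSpace ℝ (Fin 2)), 𝓘(ℝ, EuclideanSpace ℝ (Fin 2))⟯
        EuclideanSpace ℝ (Fin 2))
      (σ : AmbientIsotopy 𝓘(ℝ, EuclideanSpace ℝ (Fin 2)) (EuclideanSpace ℝ (Fin 2))),
      (∀ (r a b : ℝ), 0 ≤ r → r ≤ ρ + 2 * m → a ^ 2 + b ^ 2 = 1 →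
        Λ ((r * a) • EuclideanSpace.single 0 1 + (r * b) • EuclideanSpace.single 1 1) =
          (r * (((1 + a) - Real.exp (c * r) ^ 2 * (1 - a)) /
              ((1 + a) + Real.exp (c * r) ^ 2 * (1 - a)))) • EuclideanSpace.single 0 1 +
          (r * (2 * Real.exp (c * r) * b /
              ((1 + a) + Real.exp (c * r) ^ 2 * (1 - a)))) • EuclideanSpace.single 1 1) ∧
      (∀ (r a b : ℝ), 0 ≤ r → r ≤ ρ + 2 * m → a ^ 2 + b ^ 2 = 1 →
        Λ.symm ((r * a) • EuclideanSpace.single 0 1 + (r * b) • EuclideanSpace.single 1 1) =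
          (r * (((1 + a) - Real.exp (-(c * r)) ^ 2 * (1 - a)) /
              ((1 + a) + Real.exp (-(c * r)) ^ 2 * (1 - a)))) • EuclideanSpace.single 0 1 +
          (r * (2 * Real.exp (-(c * r)) * b /
              ((1 + a) + Real.exp (-(c * r)) ^ 2 * (1 - a)))) • EuclideanSpace.single 1 1) ∧
      (∀ z : EuclideanSpace ℝ (Fin 2), ‖z‖ ≤ ρ + 2 * m → ‖Λ z‖ = ‖z‖ ∧ ‖Λ.symm z‖ = ‖z‖) ∧
      (∀ t (z : EuclideanSpace ℝ (Fin 2)), ρ + m ≤ ‖z‖ → σ.toFun t z = z) ∧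
      (∀ y : ℝ, |y| ≤ Y →
        σ.toFun 1 (Λ.symm (g₂ y • EuclideanSpace.single 0 1 + y • EuclideanSpace.single 1 1)) =
          Λ.symm (g₁ y • EuclideanSpace.single 0 1 + y • EuclideanSpace.single 1 1)) ∧
      (∀ w : EuclideanSpace ℝ (Fin 2), Y ≤ |w 1| → ‖w‖ ≤ ρ →
        ∀ t ∈ Icc (0 : ℝ) 1, σ.toFun t (Λ.symm w) = Λ.symm w) := by
  set E0 : EuclideanSpace ℝ (Fin 2) := EuclideanSpace.single 0 1 with hE0
  set E1 : EuclideanSpace ℝ (Fin 2) := EuclideanSpace.single 1 1 with hE1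
  have hρ0 : 0 ≤ ρ := hY.trans hYρ
  obtain ⟨Λ, hfwd, hbwd, hnorm⟩ := exists_twistDiffeomorph c (ρ + 2 * m)
  -- the displacement
  set d : ℝ → ℝ := fun y ↦ g₁ y - g₂ y with hd
  have hds : ContDiff ℝ ∞ d := hg₁.sub hg₂
  have hd0 : ∀ y, Y ≤ |y| → d y = 0 := fun y hy ↦ by simp only [hd, heq y hy, sub_self]
  -- starting points: the graph of `g₂` and the two half planes inside the disc
  set S : Set (EuclideanSpace ℝ (Fin 2)) :=
    {z | (|z 1| ≤ Y ∧ z 0 = g₂ (z 1)) ∨ (Y ≤ |z 1| ∧ ‖z‖ ≤ ρ)} with hS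
  have hK : IsCompact (closedBall (0 : EuclideanSpace ℝ (Fin 2)) ρ) := isCompact_closedBall _ _
  have hKU : closedBall (0 : EuclideanSpace ℝ (Fin 2)) ρ ⊆ ball 0 (ρ + m) :=
    closedBall_subset_ball (by linarith)
  -- the tracks stay in the disc of radius `ρ`
  have htrack : ∀ z ∈ S, ∀ θ ∈ Icc (0 : ℝ) 1,
      z + (θ * d (z 1)) • E0 ∈ closedBall (0 : EuclideanSpace ℝ (Fin 2)) ρ := by
    intro z hz θ hθ
    have hzdec : z = (z 0) • E0 + (z 1) • E1 := by
      ext i; fin_cases i <;> simp [E0, E1]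
    set x : ℝ := z 0 with hxdef
    set y : ℝ := z 1 with hydef
    rw [mem_closedBall_zero_iff, hzdec]
    rcases hz with ⟨hy, hx⟩ | ⟨hy, hzn⟩
    · rw [← hxdef, ← hydef] at hx
      rw [← hydef] at hy
      have heq' : x • E0 + y • E1 + (θ * d y) • E0 = (g₂ y + θ * (g₁ y - g₂ y)) • E0 + y • E1 := by
        rw [hx]
        simp only [hd]
        rw [add_smul]
        abel
      rw [heq', norm_smul_single_add_smul_single]
      calc Real.sqrt ((g₂ y + θ * (g₁ y - g₂ y)) ^ 2 + y ^ 2)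
          ≤ Real.sqrt (ρ ^ 2) := Real.sqrt_le_sqrt (hbound y hy θ hθ)
        _ = ρ := Real.sqrt_sq hρ0
    · rw [← hydef] at hy
      rw [hd0 y hy, mul_zero, zero_smul, add_zero, ← hzdec]
      exact hzn
  obtain ⟨G, ⟨C, hC, hCU, hGC⟩, hG⟩ :=
    exists_ambientIsotopy_horizontalPush_of_subset hds hK isOpen_ball hKU htrack
  -- stationarity of the push off the disc of radius `ρ + m`
  have hGfix : ∀ t (z : EuclideanSpace ℝ (Fin 2)), ρ + m ≤ ‖z‖ → G.toFun t z = z := by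
    intro t z hz
    refine hGC t z fun hzC ↦ ?_
    have := hCU hzC
    rw [mem_ball_zero_iff] at this
    linarith
  refine ⟨Λ, G.transfer Λ.symm, hfwd, hbwd, hnorm, ?_, ?_, ?_⟩
  · intro t z hz
    exact transfer_eq_self_of_norm_le (by linarith) hnorm hGfix t z hz
  · intro y hy
    rw [transfer_symm_apply]
    congr 1
    have hmem : g₂ y • E0 + y • E1 ∈ S := by
      left
      exact ⟨by simpa [E0, E1] using hy, by simp [E0, E1]⟩
    rw [horizontalPush_one hG hmem]
    have h1 : (g₂ y • E0 + y • E1) 1 = y := by simp [E0, E1]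
    rw [h1]
    simp only [hd]
    rw [show g₁ y • E0 + y • E1 = g₂ y • E0 + y • E1 + (g₁ y - g₂ y) • E0 by
      rw [sub_smul]; abel]
  · intro w hw hwn t ht
    rw [transfer_symm_apply]
    congr 1
    have hmem : w ∈ S := Or.inr ⟨hw, hwn⟩
    rw [hG w hmem t ht, hd0 (w 1) hw, mul_zero, zero_smul, add_zero]

end SlideSweep

end Literature.Topology.FourManifolds
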